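import Mathlib.LinearAlgebra.Matrix.ToLin
import Mathlib.Analysis.RCLike.Basic
import Mathlib.GroupTheory.Perm.Sign
import Mathlib.Algebra.Algebra.Subalgebra.Lattice
import Mathlib.Algebra.BigOperators.Ring.Finset
import Mathlib.Algebra.BigOperators.GroupWithZero.Action
import HarnessLib

/-!
# A Fock-space model of the Grassmann algebra (creation/annihilation operators)

Support file for the proof of Chern's transgression identity
(`Literature.Geometry.Riemannian.div_chernTransgression_eq_eulerDensity`). We realise the exterior
(Grassmann) algebra on generators indexed by a linearly ordered finite type `ι` concretely, inside
the matrix algebra `Matrix (Finset ι) (Finset ι) ℝ` acting on the "Fock space" `Finset ι → ℝ`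
(coefficient functions on the basis `e_T`, `T ⊆ ι`): the fermionic creation operators `cr j` and
annihilation operators `an j` satisfy the canonical anticommutation relations, and
`top Y = Y univ ∅ = ⟨e_ι, Y e_∅⟩` is the Berezin integral (top coefficient). Associativity comes
for free from matrix multiplication. The second part introduces two species of generators
(`θ k`, form directions, and `χ a`, fibre directions), the commuting bilinears `z a k = θᵏχᵃ`,
the commutative subalgebra `𝒵` they generate, and the **bridge lemma** `top_prod_Lh` computing the
Berezin integral of a product of `d` linear elements of `𝒵` as a double alternating sum over
`S_d × S_d` (a "mixed discriminant").

## References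

* F. A. Berezin, *The method of second quantization* (1966), Ch. I (canonical anticommutation
  relations, Berezin integral). The material is folklore.
-/

noncomputable section

open Finset Matrix

namespace Literature.Geometry.Riemannian.Fock

variable {ι : Type*} [LinearOrder ι]

/-! ### The fermionic sign -/

/-- The fermionic sign `(-1)^{#{t ∈ T | t < j}}` picked up when a creation/annihilation operator of
index `j` moves past the occupied positions below `j`. [folklore] -/
def nsign (j : ι) (T : Finset ι) : ℝ := (-1) ^ (T.filter (· < j)).card

/-- `nsign j T = ±1`, so its square is `1`. [folklore] -/
theorem nsign_mul_self (j : ι) (T : Finset ι) : nsign j T * nsign j T = 1 := by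
  rw [nsign, ← pow_add, ← two_mul, pow_mul]
  norm_num

/-- `nsign` is never zero. [folklore] -/
theorem nsign_ne_zero (j : ι) (T : Finset ι) : nsign j T ≠ 0 := by
  intro h
  have := nsign_mul_self j T
  rw [h, mul_zero] at this
  exact zero_ne_one this

/-- Removing `j` itself does not change the sign at `j`. [folklore] -/
theorem nsign_erase_self (j : ι) (T : Finset ι) : nsign j (T.erase j) = nsign j T := by
  unfold nsign
  congr 2
  rw [Finset.filter_erase, Finset.erase_eq_of_notMem]
  simp

/-- Inserting `j` itself does not change the sign at `j`. [folklore] -/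
theorem nsign_insert_self (j : ι) (T : Finset ι) : nsign j (insert j T) = nsign j T := by
  unfold nsign
  congr 2
  rw [Finset.filter_insert]
  simp

/-- Inserting a new element below `j` flips the sign at `j`. [folklore] -/
theorem nsign_insert_of_lt {j k : ι} {T : Finset ι} (h : k < j) (hk : k ∉ T) :
    nsign j (insert k T) = -nsign j T := by
  unfold nsign
  rw [Finset.filter_insert, if_pos h, Finset.card_insert_of_notMem, pow_succ]
  · ring
  · simp [hk]

/-- Inserting an element above `j` does not change the sign at `j`. [folklore] -/
theorem nsign_insert_of_gt {j k : ι} {T : Finset ι} (h : j < k) :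
    nsign j (insert k T) = nsign j T := by
  unfold nsign
  rw [Finset.filter_insert, if_neg (not_lt.mpr h.le)]

/-- Erasing an element below `j` flips the sign at `j`. [folklore] -/
theorem nsign_erase_of_lt {j k : ι} {T : Finset ι} (h : k < j) (hk : k ∈ T) :
    nsign j (T.erase k) = -nsign j T := by
  have := nsign_insert_of_lt (T := T.erase k) h (Finset.notMem_erase k T)
  rw [Finset.insert_erase hk] at this
  rw [this, neg_neg]

/-- Erasing an element above `j` does not change the sign at `j`. [folklore] -/
theorem nsign_erase_of_gt {j k : ι} {T : Finset ι} (h : j < k) :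
    nsign j (T.erase k) = nsign j T := by
  unfold nsign
  rw [Finset.filter_erase, Finset.erase_eq_of_notMem]
  simp [not_lt.mpr h.le]

/-! ### Fock space, creation and annihilation operators -/

variable (ι) in
/-- The operator algebra: matrices indexed by the basis `e_T`, `T ⊆ ι`, of the Fock space.
[folklore] -/
abbrev Op : Type _ := Matrix (Finset ι) (Finset ι) ℝ

/-- The **creation operator** `c_j` (`c_j e_S = ± e_{S ∪ {j}}`): its matrix has the entry
`nsign j T` at `(T, T ∖ {j})` for `j ∈ T` and zeros elsewhere. [folklore] -/
def cr (j : ι) : Op ι :=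
  Matrix.of fun T S => if j ∈ T then (if S = T.erase j then nsign j T else 0) else 0

/-- The **annihilation operator** `a_j` (`a_j e_S = ± e_{S ∖ {j}}`): entry `nsign j T` at
`(T, T ∪ {j})` for `j ∉ T`. [folklore] -/
def an (j : ι) : Op ι :=
  Matrix.of fun T S => if j ∈ T then 0 else (if S = insert j T then nsign j T else 0)

variable [Fintype ι]

/-- Action of `c_j` on coefficient functions: `(c_j f)(T) = nsign j T · f (T ∖ {j})` if `j ∈ T`,
else `0`. [folklore] -/
theorem cr_mulVec (j : ι) (f : Finset ι → ℝ) (T : Finset ι) :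
    (cr j *ᵥ f) T = if j ∈ T then nsign j T * f (T.erase j) else 0 := by
  simp only [Matrix.mulVec, dotProduct, cr, Matrix.of_apply]
  by_cases hj : j ∈ T
  · simp only [hj, if_true, ite_mul, zero_mul, Finset.sum_ite_eq', Finset.mem_univ]
  · simp [hj]

/-- Action of `a_j` on coefficient functions: `(a_j f)(T) = nsign j T · f (T ∪ {j})` if `j ∉ T`,
else `0`. [folklore] -/
theorem an_mulVec (j : ι) (f : Finset ι → ℝ) (T : Finset ι) :
    (an j *ᵥ f) T = if j ∈ T then 0 else nsign j T * f (insert j T) := by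
  simp only [Matrix.mulVec, dotProduct, an, Matrix.of_apply]
  by_cases hj : j ∈ T
  · simp [hj]
  · simp only [hj, if_false, ite_mul, zero_mul, Finset.sum_ite_eq', Finset.mem_univ, if_true]

/-- Two operators agree if they act identically on coefficient functions. [folklore] -/
theorem ext_mulVec {X Y : Op ι} (h : ∀ f : Finset ι → ℝ, X *ᵥ f = Y *ᵥ f) : X = Y :=
  Matrix.toLin'.injective (LinearMap.ext fun f => by simpa [Matrix.toLin'_apply] using h f)

/-- Creation operators anticommute: `c_j c_k = -c_k c_j` (`j ≠ k`). [folklore] -/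
theorem cr_mul_cr {j k : ι} (hjk : j ≠ k) : cr j * cr k = -(cr k * cr j) := by
  refine ext_mulVec fun f => funext fun T => ?_
  simp only [← Matrix.mulVec_mulVec, Matrix.neg_mulVec, Pi.neg_apply, cr_mulVec,
    Finset.mem_erase, ne_eq, hjk, hjk.symm, not_false_eq_true, true_and]
  by_cases hj : j ∈ T
  · by_cases hk : k ∈ T
    · have hT : (T.erase j).erase k = (T.erase k).erase j := Finset.erase_right_comm
      simp only [hj, hk, if_true, hT]
      rcases lt_or_gt_of_ne hjk with h | h
      · rw [nsign_erase_of_lt h hj, nsign_erase_of_gt h]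
        ring
      · rw [nsign_erase_of_gt h, nsign_erase_of_lt h hk]
        ring
    · simp [hj, hk]
  · simp [hj]

/-- Creation operators square to zero: `c_j c_j = 0`. [folklore] -/
theorem cr_mul_self (j : ι) : cr j * cr j = 0 := by
  refine ext_mulVec fun f => funext fun T => ?_
  simp [← Matrix.mulVec_mulVec, cr_mulVec]

/-- The **canonical anticommutation relation** `a_j c_k + c_k a_j = δ_{jk}`. [folklore] -/
theorem an_mul_cr_add_cr_mul_an (j k : ι) :
    an j * cr k + cr k * an j = if j = k then 1 else 0 := by
  refine ext_mulVec fun f => funext fun T => ?_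
  simp only [Matrix.add_mulVec, ← Matrix.mulVec_mulVec, Pi.add_apply, an_mulVec, cr_mulVec,
    Finset.mem_insert, Finset.mem_erase, ne_eq]
  by_cases hjk : j = k
  · subst hjk
    simp only [if_true, Matrix.one_mulVec, true_or, not_true_eq_false, false_and, if_false]
    by_cases hj : j ∈ T
    · simp only [hj, if_true, zero_add, Finset.insert_erase hj, nsign_erase_self]
      rw [← mul_assoc, nsign_mul_self, one_mul]
    · simp only [hj, if_false, add_zero, Finset.erase_insert hj, nsign_insert_self]
      rw [← mul_assoc, nsign_mul_self, one_mul]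
  · simp only [hjk, if_false, Matrix.zero_mulVec, Pi.zero_apply, Ne.symm hjk, not_false_eq_true,
      true_and, false_or]
    by_cases hj : j ∈ T <;> by_cases hk : k ∈ T
    · simp [hj, hk]
    · simp [hj, hk]
    · simp only [hj, hk, if_true, if_false]
      rw [Finset.erase_insert_of_ne hjk]
      rcases lt_or_gt_of_ne hjk with h | h
      · rw [nsign_insert_of_lt h hj, nsign_erase_of_gt h]
        ring
      · rw [nsign_insert_of_gt h, nsign_erase_of_lt h hk]
        ring
    · simp [hj, hk]

/-- Annihilation and creation of different modes anticommute: `a_j c_k = -c_k a_j` (`j ≠ k`).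
[folklore] -/
theorem an_mul_cr_of_ne {j k : ι} (hjk : j ≠ k) : an j * cr k = -(cr k * an j) := by
  have := an_mul_cr_add_cr_mul_an j k
  rw [if_neg hjk] at this
  exact eq_neg_of_add_eq_zero_left this

/-- `a_j c_j = 1 - c_j a_j`. [folklore] -/
theorem an_mul_cr_self (j : ι) : an j * cr j = 1 - cr j * an j := by
  have := an_mul_cr_add_cr_mul_an j j
  rw [if_pos rfl] at this
  exact eq_sub_of_add_eq this

/-! ### Berezin integral (top coefficient) -/

/-- The vacuum vector `e_∅`. [folklore] -/
def vac : Finset ι → ℝ := Pi.single ∅ 1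

omit [Fintype ι] in
/-- The vacuum has no component along a nonempty set. [folklore] -/
theorem vac_apply_of_ne_empty {T : Finset ι} (hT : T ≠ ∅) : (vac : Finset ι → ℝ) T = 0 := by
  simp [vac, hT]

/-- Annihilation operators kill the vacuum. [folklore] -/
@[simp]
theorem an_mulVec_vac (j : ι) : an j *ᵥ (vac : Finset ι → ℝ) = 0 := by
  funext T
  rw [an_mulVec, vac_apply_of_ne_empty (Finset.insert_ne_empty j T), mul_zero, ite_self,
    Pi.zero_apply]

/-- The **Berezin integral** (top coefficient): the vacuum-to-top matrix element
`top Y = ⟨e_ι, Y e_∅⟩`. [folklore] -/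
def top : Op ι →ₗ[ℝ] ℝ where
  toFun Y := (Y *ᵥ vac) Finset.univ
  map_add' X Y := by simp [Matrix.add_mulVec]
  map_smul' c Y := by simp [Matrix.smul_mulVec]

/-- Unfolding of `top`. [folklore] -/
theorem top_apply (Y : Op ι) : top Y = (Y *ᵥ vac) Finset.univ := rfl

/-- `top` of a product is the iterated action on the vacuum. [folklore] -/
theorem top_mul (X Y : Op ι) : top (X * Y) = (X *ᵥ (Y *ᵥ vac)) Finset.univ := by
  rw [top_apply, Matrix.mulVec_mulVec]

/-- Nothing survives on top of an annihilation: `top (a_j Y) = 0`. [folklore] -/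
@[simp]
theorem top_an_mul (j : ι) (Y : Op ι) : top (an j * Y) = 0 := by
  simp [top_mul, an_mulVec]

/-- `top (Y a_j) = 0` since `a_j` kills the vacuum. [folklore] -/
@[simp]
theorem top_mul_an (Y : Op ι) (j : ι) : top (Y * an j) = 0 := by
  simp [top_mul]

/-- The number operator `c_b a_a` acts diagonally on a coefficient at a set containing `a` and `b`:
`(c_b a_a f)(T) = δ_{ab} f(T)`. [folklore] -/
theorem cr_an_mulVec_of_mem {a b : ι} {T : Finset ι} (ha : a ∈ T) (hb : b ∈ T)
    (f : Finset ι → ℝ) : (cr b *ᵥ (an a *ᵥ f)) T = if a = b then f T else 0 := by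
  simp only [cr_mulVec, hb, if_true, an_mulVec, Finset.mem_erase, ne_eq, ha, and_true]
  by_cases hab : a = b
  · subst hab
    simp [Finset.insert_erase ha, nsign_erase_self, ← mul_assoc, nsign_mul_self]
  · simp [hab]

/-- Trace identity behind `d ∘ Berezin = Berezin ∘ ∇`: for `i ∉ {a, b}`,
`top (c_i c_b a_a Y) = δ_{ab} top (c_i Y)`. [folklore] -/
theorem top_cr_mul_cr_mul_an {i a b : ι} (hia : i ≠ a) (hib : i ≠ b) (Y : Op ι) :
    top (cr i * cr b * an a * Y) = if a = b then top (cr i * Y) else 0 := by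
  simp only [mul_assoc, top_mul, ← Matrix.mulVec_mulVec]
  rw [cr_mulVec i, cr_mulVec i]
  simp only [Finset.mem_univ, if_true]
  rw [cr_an_mulVec_of_mem (by simp [Ne.symm hia]) (by simp [Ne.symm hib])]
  split_ifs <;> simp

/-- A creation operator on a basis vector: `c_j e_A = 0` if `j ∈ A`, else `± e_{A ∪ {j}}`.
[folklore] -/
theorem cr_mulVec_single (j : ι) (A : Finset ι) (c : ℝ) :
    cr j *ᵥ Pi.single A c = if j ∈ A then 0 else Pi.single (insert j A) (nsign j A * c) := by
  funext T
  rw [cr_mulVec]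
  by_cases hjA : j ∈ A
  · rw [if_pos hjA, Pi.zero_apply]
    split_ifs with hjT
    · rw [Pi.single_apply, if_neg, mul_zero]
      intro h
      exact Finset.notMem_erase j T (h.symm ▸ hjA)
    · rfl
  · rw [if_neg hjA]
    by_cases hT : T = insert j A
    · subst hT
      simp [Finset.erase_insert hjA, nsign_insert_self]
    · rw [Pi.single_apply, Pi.single_apply, if_neg hT]
      split_ifs with hjT h
      · exact absurd (by rw [← h, Finset.insert_erase hjT]) hT
      · rw [mul_zero]
      · rfl

/-! ### Two species of generators: form directions `θ k` and fibre directions `χ a`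

We now take `ι = Fin (d + d)`: the first `d` modes are the coordinate one-forms `dxᵏ` (`θ k`),
the last `d` modes are the fibre generators `χᵃ` (a lower index slot). -/

section Species

variable {d : ℕ}

omit [LinearOrder ι] [Fintype ι] in
/-- The two blocks of `Fin (d + d)` are disjoint. [folklore] -/
theorem castAdd_ne_natAdd (k a : Fin d) : Fin.castAdd d k ≠ Fin.natAdd d a := by
  intro h
  have := congrArg Fin.val h
  simp only [Fin.val_castAdd, Fin.val_natAdd] at this
  omega

/-- The form-direction creation operator `θᵏ = dxᵏ ∧ ·`. [folklore] -/
def θ (k : Fin d) : Op (Fin (d + d)) := cr (Fin.castAdd d k)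

/-- The fibre creation operator `χᵃ`. [folklore] -/
def χ (a : Fin d) : Op (Fin (d + d)) := cr (Fin.natAdd d a)

/-- The fibre annihilation operator `∂/∂χᵃ`. [folklore] -/
def anχ (a : Fin d) : Op (Fin (d + d)) := an (Fin.natAdd d a)

/-- `θᵏθˡ = -θˡθᵏ`. [folklore] -/
theorem θ_mul_θ {k l : Fin d} (h : k ≠ l) : θ k * θ l = -(θ l * θ k) :=
  cr_mul_cr fun h' => h (Fin.castAdd_inj.mp h')

/-- `θᵏθᵏ = 0`. [folklore] -/
@[simp]
theorem θ_mul_self (k : Fin d) : θ k * θ k = 0 := cr_mul_self _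

/-- `χᵃχᵇ = -χᵇχᵃ`. [folklore] -/
theorem χ_mul_χ {a b : Fin d} (h : a ≠ b) : χ a * χ b = -(χ b * χ a) :=
  cr_mul_cr fun h' => h ((Fin.natAdd_inj d).mp h')

/-- `χᵃχᵃ = 0`. [folklore] -/
@[simp]
theorem χ_mul_self (a : Fin d) : χ a * χ a = 0 := cr_mul_self _

/-- `θᵏχᵃ = -χᵃθᵏ`. [folklore] -/
theorem θ_mul_χ (k a : Fin d) : θ k * χ a = -(χ a * θ k) := cr_mul_cr (castAdd_ne_natAdd k a)

/-- `χᵃθᵏ = -θᵏχᵃ`. [folklore] -/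
theorem χ_mul_θ (a k : Fin d) : χ a * θ k = -(θ k * χ a) := by
  rw [θ_mul_χ, neg_neg]

/-- CAR for the fibre species: `∂_a χᵇ + χᵇ ∂_a = δ_{ab}`. [folklore] -/
theorem anχ_mul_χ_add (a b : Fin d) : anχ a * χ b + χ b * anχ a = if a = b then 1 else 0 := by
  rw [anχ, χ, an_mul_cr_add_cr_mul_an]
  simp only [Fin.natAdd_inj]

/-- `∂_a θᵏ = -θᵏ ∂_a`. [folklore] -/
theorem anχ_mul_θ (a k : Fin d) : anχ a * θ k = -(θ k * anχ a) :=
  an_mul_cr_of_ne (castAdd_ne_natAdd k a).symm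

/-- `top (∂_a Y) = 0`. [folklore] -/
@[simp]
theorem top_anχ_mul (a : Fin d) (Y : Op (Fin (d + d))) : top (anχ a * Y) = 0 := top_an_mul _ _

/-- `top (Y ∂_a) = 0`. [folklore] -/
@[simp]
theorem top_mul_anχ (Y : Op (Fin (d + d))) (a : Fin d) : top (Y * anχ a) = 0 := top_mul_an _ _

/-- The trace identity `top (θⁱ χᵇ ∂_a Y) = δ_{ab} top (θⁱ Y)`. [folklore] -/
theorem top_θ_mul_χ_mul_anχ_mul (i a b : Fin d) (Y : Op (Fin (d + d))) :
    top (θ i * χ b * anχ a * Y) = if a = b then top (θ i * Y) else 0 := by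
  rw [θ, χ, anχ, top_cr_mul_cr_mul_an (castAdd_ne_natAdd i a) (castAdd_ne_natAdd i b)]
  simp only [Fin.natAdd_inj]

/-! ### The commuting bilinears `z a k = θᵏ χᵃ` and the commutative algebra they generate -/

/-- The even element `z a k = θᵏχᵃ` (slot for a tensor component with lower index `a` and form
index `k`). [folklore] -/
def z (a k : Fin d) : Op (Fin (d + d)) := θ k * χ a

/-- `z a k · z b l = -θᵏθˡχᵃχᵇ`. [folklore] -/
private theorem z_mul_z_expand (a k b l : Fin d) :
    z a k * z b l = -(θ k * θ l * (χ a * χ b)) := by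
  calc z a k * z b l = θ k * (χ a * θ l) * χ b := by simp only [z, mul_assoc]
    _ = θ k * -(θ l * χ a) * χ b := by rw [χ_mul_θ]
    _ = -(θ k * θ l * (χ a * χ b)) := by simp only [mul_neg, neg_mul, mul_assoc]

/-- The `z a k` commute pairwise. [folklore] -/
theorem z_comm (a k b l : Fin d) : z a k * z b l = z b l * z a k := by
  rw [z_mul_z_expand, z_mul_z_expand]
  by_cases hkl : k = l
  · subst hkl
    simp
  · by_cases hab : a = b
    · subst hab
      simp
    · rw [θ_mul_θ hkl, χ_mul_χ hab, neg_mul_neg]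

/-- Two `z`'s with the same fibre index multiply to zero. [folklore] -/
@[simp]
theorem z_mul_z_fst (a k l : Fin d) : z a k * z a l = 0 := by
  rw [z_mul_z_expand]
  simp

/-- Two `z`'s with the same form index multiply to zero. [folklore] -/
@[simp]
theorem z_mul_z_snd (a b k : Fin d) : z a k * z b k = 0 := by
  rw [z_mul_z_expand]
  simp

/-- The determinantal relation `z a l · z b k = - z a k · z b l`. [folklore] -/
theorem z_swap (a b k l : Fin d) : z a l * z b k = -(z a k * z b l) := by
  by_cases hkl : k = l
  · subst hkl
    simp
  · rw [z_mul_z_expand, z_mul_z_expand, θ_mul_θ (Ne.symm hkl), neg_mul, neg_neg]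

variable (d) in
/-- The commutative subalgebra `𝒵` generated by the `z a k`. [folklore] -/
def 𝒵 : Subalgebra ℝ (Op (Fin (d + d))) :=
  Algebra.adjoin ℝ (Set.range fun p : Fin d × Fin d => z p.1 p.2)

/-- `𝒵` is commutative (its generators commute pairwise). [folklore] -/
instance 𝒵.isMulCommutative : IsMulCommutative (𝒵 d) :=
  Algebra.isMulCommutative_adjoin ℝ (by
    rintro _ ⟨p, rfl⟩ _ ⟨q, rfl⟩
    exact z_comm _ _ _ _)

open scoped IsMulCommutative

/-- The generator `z a k` as an element of `𝒵`. [folklore] -/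
def zh (a k : Fin d) : 𝒵 d := ⟨z a k, Algebra.subset_adjoin ⟨(a, k), rfl⟩⟩

/-- Coercion of `zh`. [folklore] -/
@[simp]
theorem coe_zh (a k : Fin d) : ((zh a k : 𝒵 d) : Op (Fin (d + d))) = z a k := rfl

/-- Repeated fibre index kills a product in `𝒵`. [folklore] -/
@[simp]
theorem zh_mul_zh_fst (a k l : Fin d) : zh a k * zh a l = 0 :=
  Subtype.ext (by simp)

/-- Repeated form index kills a product in `𝒵`. [folklore] -/
@[simp]
theorem zh_mul_zh_snd (a b k : Fin d) : zh a k * zh b k = 0 :=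
  Subtype.ext (by simp)

/-- The determinantal relation in `𝒵`. [folklore] -/
theorem zh_swap (a b k l : Fin d) : zh a l * zh b k = -(zh a k * zh b l) :=
  Subtype.ext (by simp [z_swap a b k l])

/-! ### The Berezin integral of a product of `d` generators: a double determinant -/

/-- A product of `z`'s with a repeated fibre index vanishes. [folklore] -/
theorem prod_zh_eq_zero_of_fst {α : Fin d → Fin d} (h : ¬Function.Injective α)
    (κ : Fin d → Fin d) : ∏ s, zh (α s) (κ s) = 0 := by
  simp only [Function.Injective, not_forall] at h
  obtain ⟨s, t, hst, hne⟩ := h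
  rw [← Finset.mul_prod_erase _ _ (Finset.mem_univ s),
    ← Finset.mul_prod_erase _ _ (Finset.mem_erase.mpr ⟨Ne.symm hne, Finset.mem_univ t⟩),
    ← mul_assoc, hst, zh_mul_zh_fst, zero_mul]

/-- A product of `z`'s with a repeated form index vanishes. [folklore] -/
theorem prod_zh_eq_zero_of_snd (α : Fin d → Fin d) {κ : Fin d → Fin d}
    (h : ¬Function.Injective κ) : ∏ s, zh (α s) (κ s) = 0 := by
  simp only [Function.Injective, not_forall] at h
  obtain ⟨s, t, hst, hne⟩ := h
  rw [← Finset.mul_prod_erase _ _ (Finset.mem_univ s),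
    ← Finset.mul_prod_erase _ _ (Finset.mem_erase.mpr ⟨Ne.symm hne, Finset.mem_univ t⟩),
    ← mul_assoc, hst, zh_mul_zh_snd, zero_mul]

variable (d) in
/-- The normalisation `β = top (∏ₛ z s s)` (`= ±1`). [folklore] -/
def β : ℝ := top ((∏ s : Fin d, zh s s : 𝒵 d) : Op (Fin (d + d)))

/-- Permuting the fibre indices of the diagonal product costs the sign of the permutation.
[folklore] -/
theorem top_prod_zh_perm (π : Equiv.Perm (Fin d)) :
    top ((∏ s, zh (π s) s : 𝒵 d) : Op (Fin (d + d))) = ((Equiv.Perm.sign π : ℤ) : ℝ) * β d := by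
  induction π using Equiv.Perm.swap_induction_on' with
  | one => simp [β]
  | mul_swap f x y hxy ih =>
    have hy : y ∈ Finset.univ.erase x := Finset.mem_erase.mpr ⟨Ne.symm hxy, Finset.mem_univ y⟩
    have hrest : ∏ s ∈ (Finset.univ.erase x).erase y, zh ((f * Equiv.swap x y) s) s =
        ∏ s ∈ (Finset.univ.erase x).erase y, zh (f s) s := by
      refine Finset.prod_congr rfl fun s hs => ?_
      simp only [Finset.mem_erase, ne_eq, Finset.mem_univ, and_true] at hs
      rw [Equiv.Perm.mul_apply, Equiv.swap_apply_of_ne_of_ne hs.2 hs.1]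
    have e1 : ∏ s, zh ((f * Equiv.swap x y) s) s =
        zh (f y) x * (zh (f x) y * ∏ s ∈ (Finset.univ.erase x).erase y, zh (f s) s) := by
      rw [← Finset.mul_prod_erase _ _ (Finset.mem_univ x), ← Finset.mul_prod_erase _ _ hy,
        hrest]
      simp only [Equiv.Perm.mul_apply, Equiv.swap_apply_left, Equiv.swap_apply_right]
    have e2 : ∏ s, zh (f s) s =
        zh (f x) x * (zh (f y) y * ∏ s ∈ (Finset.univ.erase x).erase y, zh (f s) s) := by
      rw [← Finset.mul_prod_erase _ _ (Finset.mem_univ x), ← Finset.mul_prod_erase _ _ hy]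
    have key : ∏ s, zh ((f * Equiv.swap x y) s) s = -∏ s, zh (f s) s := by
      rw [e1, e2, ← mul_assoc, zh_swap (f y) (f x) y x]
      ring
    rw [key, Subalgebra.coe_neg, map_neg, ih]
    simp only [Equiv.Perm.sign_mul, Equiv.Perm.sign_swap hxy, Units.val_mul, Units.val_neg,
      Units.val_one, Int.cast_mul, Int.cast_neg, Int.cast_one]
    ring

/-- `top (∏ₛ z (σ s) (τ s)) = sgn σ · sgn τ · β`. [folklore] -/
theorem top_prod_zh_perm_perm (σ τ : Equiv.Perm (Fin d)) :
    top ((∏ s, zh (σ s) (τ s) : 𝒵 d) : Op (Fin (d + d))) =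
      ((Equiv.Perm.sign σ : ℤ) : ℝ) * ((Equiv.Perm.sign τ : ℤ) : ℝ) * β d := by
  have : ∏ s, zh (σ s) (τ s) = ∏ s, zh ((σ * τ⁻¹) s) s := by
    rw [← Equiv.prod_comp τ⁻¹ (fun s => zh (σ s) (τ s))]
    simp [Equiv.Perm.mul_apply]
  rw [this, top_prod_zh_perm]
  simp only [Equiv.Perm.sign_mul, Equiv.Perm.sign_inv, Units.val_mul, Int.cast_mul]

/-- Sums over permutations are sums over injective self-maps. [folklore] -/
theorem sum_perm_eq_sum_ite_injective (G : (Fin d → Fin d) → ℝ) :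
    ∑ σ : Equiv.Perm (Fin d), G σ =
      ∑ α : Fin d → Fin d, if Function.Injective α then G α else 0 := by
  rw [← Finset.sum_filter]
  refine Finset.sum_nbij (fun σ => (σ : Fin d → Fin d)) ?_ ?_ ?_ ?_
  · intro σ _
    simp [σ.injective]
  · intro σ _ τ _ h
    exact Equiv.ext (congrFun h)
  · intro α hα
    simp only [Finset.coe_filter, Finset.mem_univ, true_and, Set.mem_setOf_eq] at hα
    exact ⟨Equiv.ofBijective α (Finite.injective_iff_bijective.mp hα), by simp, rfl⟩
  · intro σ _
    rfl

/-- Sums over permutations are sums over injective self-maps (dependent version). [folklore] -/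
theorem sum_perm_eq_sum_dite_injective (G : Equiv.Perm (Fin d) → ℝ) :
    ∑ σ : Equiv.Perm (Fin d), G σ =
      ∑ α : Fin d → Fin d, if h : Function.Injective α then
        G (Equiv.ofBijective α (Finite.injective_iff_bijective.mp h)) else 0 := by
  set F : (Fin d → Fin d) → ℝ := fun α => if h : Function.Injective α then
    G (Equiv.ofBijective α (Finite.injective_iff_bijective.mp h)) else 0 with hF
  have hGF : ∀ σ : Equiv.Perm (Fin d), G σ = F σ := fun σ => by
    simp only [hF, σ.injective, dif_pos]
    congr 1
    exact Equiv.ext fun _ => rfl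
  calc ∑ σ : Equiv.Perm (Fin d), G σ = ∑ σ : Equiv.Perm (Fin d), F σ :=
        Finset.sum_congr rfl fun σ _ => hGF σ
    _ = ∑ α : Fin d → Fin d, if Function.Injective α then F α else 0 :=
        sum_perm_eq_sum_ite_injective F
    _ = _ := Finset.sum_congr rfl fun α _ => by
        by_cases h : Function.Injective α <;> simp [hF, h]

/-- The Berezin integral of an arbitrary product of `d` generators. [folklore] -/
theorem top_prod_zh (α κ : Fin d → Fin d) :
    top ((∏ s, zh (α s) (κ s) : 𝒵 d) : Op (Fin (d + d))) =
      if hα : Function.Injective α then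
        if hκ : Function.Injective κ then
          ((Equiv.Perm.sign (Equiv.ofBijective α (Finite.injective_iff_bijective.mp hα)) : ℤ) :
              ℝ) *
            ((Equiv.Perm.sign (Equiv.ofBijective κ (Finite.injective_iff_bijective.mp hκ)) : ℤ) :
              ℝ) * β d
        else 0
      else 0 := by
  split_ifs with hα hκ
  · exact top_prod_zh_perm_perm (Equiv.ofBijective α _) (Equiv.ofBijective κ _)
  · rw [prod_zh_eq_zero_of_snd α hκ]
    simp
  · rw [prod_zh_eq_zero_of_fst hα κ]
    simp

/-- The diagonal bilinear on a basis vector avoiding both of its modes. [folklore] -/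
theorem z_mulVec_single (s : Fin d) (A : Finset (Fin (d + d))) (c : ℝ)
    (h1 : Fin.natAdd d s ∉ A) (h2 : Fin.castAdd d s ∉ A) :
    z s s *ᵥ Pi.single A c =
      Pi.single (insert (Fin.castAdd d s) (insert (Fin.natAdd d s) A))
        (nsign (Fin.castAdd d s) (insert (Fin.natAdd d s) A) * (nsign (Fin.natAdd d s) A * c)) := by
  rw [z, θ, χ, ← Matrix.mulVec_mulVec, cr_mulVec_single, if_neg h1, cr_mulVec_single,
    if_neg (Finset.mem_insert.not.mpr (not_or.mpr ⟨castAdd_ne_natAdd s s, h2⟩))]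

/-- The diagonal product `∏_{s ∈ S} z s s` maps the vacuum to `±` a basis vector. [folklore] -/
theorem prod_zh_diag_mulVec_vac (S : Finset (Fin d)) :
    ∃ c : ℝ, c ≠ 0 ∧ ((∏ s ∈ S, zh s s : 𝒵 d) : Op (Fin (d + d))) *ᵥ vac =
      Pi.single (S.image (Fin.castAdd d) ∪ S.image (Fin.natAdd d)) c := by
  induction S using Finset.induction_on with
  | empty =>
    refine ⟨1, one_ne_zero, ?_⟩
    rw [Finset.prod_empty, Subalgebra.coe_one, Matrix.one_mulVec, Finset.image_empty,
      Finset.image_empty, Finset.empty_union]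
    rfl
  | insert s S hs ih =>
    obtain ⟨c, hc, h⟩ := ih
    have h1 : Fin.natAdd d s ∉ S.image (Fin.castAdd d) ∪ S.image (Fin.natAdd d) := by
      simp only [Finset.mem_union, Finset.mem_image, not_or, not_exists, not_and]
      exact ⟨fun k _ => castAdd_ne_natAdd k s, fun a ha h => hs ((Fin.natAdd_inj d).mp h ▸ ha)⟩
    have h2 : Fin.castAdd d s ∉ S.image (Fin.castAdd d) ∪ S.image (Fin.natAdd d) := by
      simp only [Finset.mem_union, Finset.mem_image, not_or, not_exists, not_and]
      exact ⟨fun k hk h => hs (Fin.castAdd_inj.mp h ▸ hk), fun a _ h => castAdd_ne_natAdd s a h.symm⟩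
    set A := S.image (Fin.castAdd d) ∪ S.image (Fin.natAdd d) with hA
    refine ⟨nsign (Fin.castAdd d s) (insert (Fin.natAdd d s) A) * (nsign (Fin.natAdd d s) A * c),
      mul_ne_zero (nsign_ne_zero _ _) (mul_ne_zero (nsign_ne_zero _ _) hc), ?_⟩
    rw [Finset.prod_insert hs, Subalgebra.coe_mul, ← Matrix.mulVec_mulVec, h, coe_zh,
      z_mulVec_single s _ c h1 h2]
    congr 1
    simp only [hA, Finset.image_insert, Finset.insert_union, Finset.union_insert]
    exact Finset.insert_comm _ _ _

/-- The normalisation constant `β` is nonzero (in fact `= ±1`). [folklore] -/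
theorem β_ne_zero : β d ≠ 0 := by
  obtain ⟨c, hc, h⟩ := prod_zh_diag_mulVec_vac (Finset.univ : Finset (Fin d))
  rw [β, top_apply, h]
  have : Finset.univ.image (Fin.castAdd d) ∪ Finset.univ.image (Fin.natAdd d) = Finset.univ := by
    ext i
    simp only [Finset.mem_union, Finset.mem_image, Finset.mem_univ, true_and, iff_true]
    rcases lt_or_ge i.val d with hi | hi
    · exact Or.inl ⟨⟨i, hi⟩, Fin.ext rfl⟩
    · exact Or.inr ⟨⟨i - d, by omega⟩, Fin.ext (by simp; omega)⟩
  rw [this, Pi.single_eq_same]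
  exact hc

/-! ### The bridge: Berezin integrals of products of linear elements are double alternating sums -/

/-- The linear element `L(A) = ∑_{a,k} A a k · z a k` of `𝒵`. [folklore] -/
def Lh (A : Fin d → Fin d → ℝ) : 𝒵 d := ∑ a, ∑ k, A a k • zh a k

/-- **Bridge lemma.** The Berezin integral of a product of `d` linear elements is `β` times the
mixed double alternating sum `∑_{σ,τ} sgn σ sgn τ ∏ₛ Mₛ(σ s, τ s)`. [folklore] -/
theorem top_prod_Lh (M : Fin d → Fin d → Fin d → ℝ) :
    top ((∏ s, Lh (M s) : 𝒵 d) : Op (Fin (d + d))) =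
      β d * ∑ σ : Equiv.Perm (Fin d), ∑ τ : Equiv.Perm (Fin d),
        ((Equiv.Perm.sign σ : ℤ) : ℝ) * ((Equiv.Perm.sign τ : ℤ) : ℝ) * ∏ s, M s (σ s) (τ s) := by
  -- expand the product of sums, first over the fibre indices `α`, then over the form indices `κ`
  unfold Lh
  rw [Fintype.prod_sum]
  simp_rw [Fintype.prod_sum, Finset.prod_smul]
  rw [AddSubmonoidClass.coe_finsetSum, map_sum]
  simp_rw [AddSubmonoidClass.coe_finsetSum, map_sum, Subalgebra.coe_smul, map_smul, smul_eq_mul,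
    top_prod_zh]
  -- restrict to injective maps = permutations
  rw [Finset.mul_sum]
  simp_rw [Finset.mul_sum, sum_perm_eq_sum_dite_injective]
  refine Finset.sum_congr rfl fun α _ => ?_
  by_cases hα : Function.Injective α
  · simp only [hα, dif_pos]
    refine Finset.sum_congr rfl fun κ _ => ?_
    by_cases hκ : Function.Injective κ
    · simp only [hκ, dif_pos, Equiv.ofBijective_apply]
      ring
    · simp [hκ]
  · simp [hα]

end Species

end Literature.Geometry.Riemannian.Fock
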